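import Summits.QuantumAdvantage.QuantumAdvantage.Theses.CompactnessLift
import Summits.QuantumAdvantage.QuantumAdvantage.Theorems.CompactnessLiftLanguageLadderSummitStrength
import Literature.Computability.Complexity.RelativizedTime
import Literature.Computability.QuantumComplexity.BQTime
import Literature.Computability.Cryptography.Postselection

/-!
# CensusG1 — kernel-checked companion of the gen-1 STRATEGY-CENSUS for the crux `LanguageLadder`
# (stmt-QuantumAdvantage-15271, route CompactnessLift)

Seat `planner-cstrat-stmt-QuantumAdvantage-15271-0` (crux-strategist, gen 1, after lead cycle c1).
Everything here is bound to the REAL route decls and is UNCONDITIONAL unless a hypothesis is an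
explicit argument. Since gen 0 (`Census.lean`, cstrat-b1) the padding collapse landed, so the typed
crux is now *by a tree theorem* `¬ (BQTime (·^2) ⊆ BPP)`
(`CompactnessLiftLanguageLadder.languageLadder_iff_not_BQTime_two_subset_BPP`) and implies the
summit (`quantumAdvantage_of_languageLadder`).

Sections:
* §1 THE HONEST SPLIT (Decomposition D0): `LanguageLadder ↔ UniformExponentLift ∧ LanguageLadderR`
  — the typed crux factors EXACTLY into the route's intended pair, re-typed over honest `BPTime`:
  the quadratic-window compactness principle and the fixed-exponent ladder. Glue
  `languageLadder_of_subs` is sorry-free NOW; both children follow from the parent; neither child is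
  the parent reworded (§1b records what is known about the converse directions).
* §1c relation to the refuter's `CP′` (antecedent `BQP ⊆ BPP`): `UniformExponentLift → CP′`
  outright, `CP′ → SummitGivesLadder → UniformExponentLift` (the route's own support 15274 is the
  exact difference).
* §2 Decomposition D4 (derandomization split): `¬ (BQTime (·^2) ⊆ P)` and `BPP ⊆ P` give the crux;
  the parent gives the first piece back (`P ⊆ BPP`). Recorded, NOT filed (both pieces summit-class).
* §3 Transfer T4 (the sampling sibling): the non-transferring step typed —
  `DecisionPostselectionLift := BQP ⊆ BPP → PostBQP ⊆ PostBPP`; with Aaronson's `PostBQP = PP` it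
  would give `BQP ⊆ BPP → PP ⊆ PostBPP` (a counting-hierarchy collapse), the decision analogue of the
  Stockmeyer/post-selection supremacy argument; it is exactly what deciders (unlike samplers) do not
  supply.
* §4 Strengthen S⁺₅ (almost-everywhere ladder): typed; implies `LanguageLadderR`; no converse.
-/

set_option linter.dupNamespace false

namespace Summit.QuantumAdvantage.QuantumAdvantage.Cruxes.LanguageLadder.CensusG1

open Literature.Computability.Complexity Literature.Computability.QuantumComplexity
  Literature.Computability.Cryptography
open Summit.QuantumAdvantage.QuantumAdvantage.Theses.CompactnessLift
open Summit.QuantumAdvantage.QuantumAdvantage.Theorems.CompactnessLiftLanguageLadder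

/-! ## §1 The honest split of the typed crux (Decomposition D0 — the one with teeth) -/

/-- **Child 1 · `UniformExponentLift`** (the compactness principle on the quadratic window, honest
`BPTIME`): if every quadratic-time-uniform Clifford+T language is in `BPP`, then ONE exponent `c`
serves them all. Vacuously true under the summit; true with an explicit exponent in the
Fortnow–Rogers/FFKL generic world (route item 15279); relativizingly unprovable iff OracleDichotomy
(15277) is positive. -/
def UniformExponentLift : Prop :=
  BQTime (fun n => n ^ 2) ⊆ BPP → ∃ c : ℕ, BQTime (fun n => n ^ 2) ⊆ BPTime (fun n => n ^ c)

/-- **Child 2 · `LanguageLadderR`** (the refuter's repair C′, verbatim; Disproof §6, Census §1,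
LeadVerdict `LanguageLadderRepaired`): for every exponent `c` some quadratic-time-uniform Clifford+T
language lies outside honest `BPTIME(n^c)`. Hypothesis-type (implied by the summit modulo quadratic
padding; implies `PP ⊄ BPP` modulo folklore, Ideator2 B0). -/
def LanguageLadderR : Prop :=
  ∀ c : ℕ, ∃ L ∈ BQTime (fun n => n ^ 2), L ∉ BPTime (fun n => n ^ c)

/-- **Glue (sorry-free, unconditional)**: the two children give the typed crux. This is the
statement a prover lands as `Theorems/CompactnessLiftLanguageLadderSplit.lean` for
`route edit --split LanguageLadder --glue-by`. [folklore] -/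
theorem languageLadder_of_subs (h₁ : UniformExponentLift) (h₂ : LanguageLadderR) : LanguageLadder := by
  rw [languageLadder_iff_not_BQTime_two_subset_BPP]
  intro hsub
  obtain ⟨c, hc⟩ := h₁ hsub
  obtain ⟨L, hL, hLc⟩ := h₂ c
  exact hLc (hc hL)

/-- The parent gives child 1 (vacuously: the parent IS `¬` the antecedent). [folklore] -/
theorem uniformExponentLift_of_languageLadder (h : LanguageLadder) : UniformExponentLift := fun hsub =>
  absurd hsub (languageLadder_iff_not_BQTime_two_subset_BPP.1 h)

/-- The parent gives child 2 (typed ⟹ repaired; `BPTime (·^c) ⊆ BPP`). [folklore] -/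
theorem languageLadderR_of_languageLadder (h : LanguageLadder) : LanguageLadderR := by
  have hX := languageLadder_iff_not_BQTime_two_subset_BPP.1 h
  intro c
  by_contra hc
  push Not at hc
  exact hX fun L hL => BPTime_pow_subset_BPP c (hc L hL)

/-- **The split is exact**: `LanguageLadder ↔ UniformExponentLift ∧ LanguageLadderR`. [folklore] -/
theorem languageLadder_iff_subs : LanguageLadder ↔ UniformExponentLift ∧ LanguageLadderR :=
  ⟨fun h => ⟨uniformExponentLift_of_languageLadder h, languageLadderR_of_languageLadder h⟩,
    fun h => languageLadder_of_subs h.1 h.2⟩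

/-! ### §1b What each child is, alone (why neither is the parent reworded)

* `UniformExponentLift ↔ (LanguageLadderR → LanguageLadder)` — pure logic (below): child 1 is the
  BRIDGE of a bridge split `T ∧ (T → X)` with `T = LanguageLadderR`. By the human ruling on BC2
  redirects this is admissible iff `T` is substantive/open and does not give `X` alone: `T` is open
  (it implies `PP ⊄ BPP`, Ideator2 B0), and `T → X` is NOT known — it is literally child 1, whose
  relativized status is the route's open item OracleDichotomy (15277); the Heller-type oracle of
  BarrierNotes LL-B1 makes `T` itself fail relativized (so `T` is non-relativizing, not summit-equivalent).
* `LanguageLadderR` alone ↛ summit as far as anyone knows (same open item); parent → child is strict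
  in every relativized world where `BQP = BPP` with unbounded exponents, if such a world exists. -/

/-- Child 1 is exactly "child 2 implies the parent". [folklore] -/
theorem uniformExponentLift_iff_imp : UniformExponentLift ↔ (LanguageLadderR → LanguageLadder) := by
  constructor
  · exact fun h₁ h₂ => languageLadder_of_subs h₁ h₂
  · intro h hsub
    by_contra hno
    push Not at hno
    have hR : LanguageLadderR := fun c => Set.not_subset.1 (hno c)
    exact (languageLadder_iff_not_BQTime_two_subset_BPP.1 (h hR)) hsub

/-- Equivalently child 1 is "parent or a uniform-exponent dequantization". [folklore] -/
theorem uniformExponentLift_iff_or :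
    UniformExponentLift ↔ LanguageLadder ∨ ∃ c : ℕ, BQTime (fun n => n ^ 2) ⊆ BPTime (fun n => n ^ c) := by
  rw [languageLadder_iff_not_BQTime_two_subset_BPP]
  unfold UniformExponentLift
  tauto

/-- What a refutation of child 2 is: a uniform-exponent dequantization (hence, by
`not_languageLadder_iff_BQTime_two_subset_BPP`, a refutation of the parent and of the summit's
quadratic window). [folklore] -/
theorem not_languageLadderR_iff :
    ¬ LanguageLadderR ↔ ∃ c : ℕ, BQTime (fun n => n ^ 2) ⊆ BPTime (fun n => n ^ c) := by
  simp only [LanguageLadderR, not_forall, not_exists, not_and, not_not]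
  rfl

/-! ### §1c Relation to the refuter's `CP′` (antecedent `BQP ⊆ BPP`) -/

/-- The refuter's repaired compactness principle (rattack-15271 `CompactnessPrincipleRepaired`,
Census `CompactnessPrincipleR`). -/
def CompactnessPrincipleR : Prop :=
  BQP ⊆ BPP → ∃ c : ℕ, BQTime (fun n => n ^ 2) ⊆ BPTime (fun n => n ^ c)

/-- `UniformExponentLift → CP′` outright (`BQTime (·^2) ⊆ BQP`). [folklore] -/
theorem compactnessPrincipleR_of_uniformExponentLift (h : UniformExponentLift) : CompactnessPrincipleR :=
  fun hsub => h fun _ hL => hsub (BQTime_pow_subset_BQP 2 hL)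

/-- `CP′ → SummitGivesLadder → UniformExponentLift`: the difference between the two typings of the
lift is exactly the route's own open support item 15274 (quadratic padding of one witness,
`summitGivesLadder_iff`). [folklore] -/
theorem uniformExponentLift_of_compactnessPrincipleR (h : CompactnessPrincipleR)
    (hpad : SummitGivesLadder) : UniformExponentLift := by
  intro hsub
  refine h fun L hL => ?_
  by_contra hLB
  exact (summitGivesLadder_iff.1 hpad ⟨L, hL, hLB⟩) hsub

/-- Hence the refuter's `closes_repaired` shape, against the typed parent:
`CP′ → SummitGivesLadder → LanguageLadderR → LanguageLadder` (a 3-piece variant of the split whose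
middle piece is the existing item 15274). [folklore] -/
theorem languageLadder_of_subs₃ (h₁ : CompactnessPrincipleR) (h₂ : SummitGivesLadder)
    (h₃ : LanguageLadderR) : LanguageLadder :=
  languageLadder_of_subs (uniformExponentLift_of_compactnessPrincipleR h₁ h₂) h₃

/-! ## §2 Decomposition D4 — the derandomization split (recorded, not filed) -/

/-- Piece A: quantum quadratic time is not inside deterministic polynomial time. WEAKER than the
parent (`P ⊆ BPP`); still summit-class (`⟹ P ≠ PSPACE` by the A03 argument with `P` for `BPP`). -/
def QuadQNotSubsetP : Prop :=
  ¬ (BQTime (fun n => n ^ 2) ⊆ Classes.P)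

/-- Piece B: full derandomization `BPP ⊆ P` (Impagliazzo–Wigderson-type conclusion; open; implies
circuit lower bounds via Kabanets–Impagliazzo). -/
def Derandomization : Prop :=
  BPP ⊆ Classes.P

/-- Glue of D4 (sorry-free): A and B give the typed crux. [folklore] -/
theorem languageLadder_of_derandomization_split (hA : QuadQNotSubsetP) (hB : Derandomization) :
    LanguageLadder := by
  rw [languageLadder_iff_not_BQTime_two_subset_BPP]
  exact fun hsub => hA (hsub.trans hB)

/-- The parent gives piece A back (`P ⊆ BPP`, tree theorem `P_subset_BPP_holds`): A is a
CONSEQUENCE of the crux, B is independent of it. Neither piece alone gives the parent (A needs B;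
B is classical). Which piece remains "the whole difficulty": both are famous open problems with
their own barriers (A: SeparationPrerequisites with `P` for `BPP`; B: derandomization ⟹ circuit
lower bounds) — no plan for either side, so D4 is NOT a redirect (human ruling (d)). [folklore] -/
theorem quadQNotSubsetP_of_languageLadder (hP : P_subset_BPP) (h : LanguageLadder) : QuadQNotSubsetP := by
  rw [languageLadder_iff_not_BQTime_two_subset_BPP] at h
  exact fun hsub => h (hsub.trans hP)

/-! ## §3 Transfer T4 — the sampling sibling's engine, and the step that does not transfer -/

/-- The decision analogue of "a classical sampler can be post-selected": **if `BQP ⊆ BPP` then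
`PostBQP ⊆ PostBPP`**. This is the step the Stockmeyer/post-selection supremacy theorems
(Bremner–Jozsa–Shepherd 2011, Aaronson–Arkhipov 2011) get for free from a SAMPLER and that a
DECIDER does not supply: conditional acceptance probabilities of post-selected circuits are not
`BQP` languages. Nobody conjectures it; relative to the Fortnow–Rogers oracle (`P = BQP`, `PH`
infinite, tree `fortnowRogers1999_cor37_holds`) it fails, given the relativizing
`PostBQP = PP` / `PostBPP ⊆ BPP^NP` / Toda. -/
def DecisionPostselectionLift : Prop :=
  BQP ⊆ BPP → PostBQP ⊆ PostBPP

/-- What the transferred argument would yield: with Aaronson's `PostBQP = PP` (tree NAMED FACT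
`PostBQP_eq_PP`, unproved in-tree, explicit hypothesis) the lift turns `BQP ⊆ BPP` into the
counting-class collapse `PP ⊆ PostBPP` (`= BPP_path ⊆ BPP^NP`), whence `PH ⊆ P^PP` collapses (Toda).
So T4 = "summit ⟸ (PP ⊄ PostBPP) ∧ DecisionPostselectionLift": the first conjunct is a believable
classical non-collapse, the second is the non-transferring, non-relativizing step — the whole crux
again (pattern QA-A06 `not_relativizes_collapse_template`). [folklore] -/
theorem PP_subset_PostBPP_of_lift (hA : PostBQP_eq_PP) (hlift : DecisionPostselectionLift)
    (hsub : BQP ⊆ BPP) : PP ⊆ PostBPP := by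
  have h := hlift hsub
  unfold PostBQP_eq_PP at hA
  rw [hA] at h
  exact h

/-- Contrapositive reading used in the census: a believable classical non-collapse plus the lift
would prove the summit's class form `¬ BQP ⊆ BPP`. [folklore] -/
theorem not_BQP_subset_BPP_of_lift (hA : PostBQP_eq_PP) (hlift : DecisionPostselectionLift)
    (hPP : ¬ PP ⊆ PostBPP) : ¬ BQP ⊆ BPP :=
  fun hsub => hPP (PP_subset_PostBPP_of_lift hA hlift hsub)

/-! ## §4 Strengthen S⁺₅ — the almost-everywhere ladder (typed; strictly more rigid, no new tool) -/

/-- `L` and `L'` disagree at every sufficiently large input LENGTH. -/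
def DisagreeAE (L L' : Language Bool) : Prop :=
  ∃ n₀ : ℕ, ∀ n, n₀ ≤ n → ∃ x : List Bool, x.length = n ∧ (x ∈ L ↔ x ∉ L')

/-- **S⁺₅ · almost-everywhere ladder**: for every `c` some quadratic-uniform quantum language that
EVERY `BPTIME(n^c)` language gets wrong at all large lengths (the form immune to
"infinitely-often" padding tricks and the one direct-product / hardness-amplification theorems
speak about). -/
def LanguageLadderAE : Prop :=
  ∀ c : ℕ, ∃ L ∈ BQTime (fun n => n ^ 2), ∀ L' ∈ BPTime (fun n => n ^ c), DisagreeAE L L'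

/-- S⁺₅ implies child 2 (a language disagreeing with every member is not a member). The converse
is open and presumably false as a general implication (io- vs ae-hardness); the added rigidity buys
amplification of an EXISTING hard language, never the existence of one — see the census. [folklore] -/
theorem languageLadderR_of_ae (h : LanguageLadderAE) : LanguageLadderR := by
  intro c
  obtain ⟨L, hL, hall⟩ := h c
  refine ⟨L, hL, fun hmem => ?_⟩
  obtain ⟨n₀, hn₀⟩ := hall L hmem
  obtain ⟨x, -, hx⟩ := hn₀ n₀ le_rfl
  exact iff_not_self hx

end Summit.QuantumAdvantage.QuantumAdvantage.Cruxes.LanguageLadder.CensusG1
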